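import Summits.Parity.GeneralizedHardyLittlewood.Theorems.ChenParityOracleBLAPHostParityFromBrickPrimeHostEventually
import Summits.Parity.GeneralizedHardyLittlewood.Theorems.ChenParityOracleBLAPHostParityFromBrickSiftedTypeI
import Summits.Parity.GeneralizedHardyLittlewood.Theorems.ChenParityOracleBLAPHostParityFromBrickTypeIIPairs
import Summits.Parity.GeneralizedHardyLittlewood.Theorems.ChenParityOracleBLAPHostParityFromBrickPrimesAbel
import HarnessLib

/-!
# Route `ChenParityOracleBLAP` — crux S1 = `HostParityFromBrick` (stmt-Parity-20045): the prime half, given K1/K2 eventually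

Support file for the prime half `K1 → K2 → HP1` of S1 (step (F2), final).  Given the K1/K2 bodies
for all large `x` (on a `δ`-window with saving `A = 90`, `0 < δ ≤ 1/12`), for every `ε, η > 0`:
`∑_{d ≤ x^{1/2−ε}} |∑_{p ≤ x, d ∣ p+2} λ(p+2)| ≤ η x/(log x)²` for all large `x`
(`prime_eventually`): partial summation from primes to `Λ` (`sum_abs_primes_le_abel`), the level
sums at all heights (`level_sum_le_all_heights`, fed by `sifted_typeI` and the brick through
`HTII_of_K`), the envelope `level_envelope_le`, and the thresholds `prime_thresholds` /
`final_numeric_le`.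

References: H. Iwaniec, E. Kowalski, *Analytic Number Theory* (2004), §13.4, §17.3
[IwaniecKowalski2004]; E. Bombieri, J. Friedlander, H. Iwaniec, Acta Math. 156 (1986) [BFI1986].
-/

namespace Summit.Parity.GeneralizedHardyLittlewood.Theorems

open Finset Real Filter
open ArithmeticFunction
open scoped ArithmeticFunction.sigma

/-- **The prime half of S1, given K1 and K2 eventually.** -/
theorem prime_eventually {δ : ℝ} (hδ0 : 0 < δ) (hδ1 : δ ≤ 1 / 12) {ε : ℝ} (hε : 0 < ε)
    {x₁ x₂ : ℕ}
    (hK1 : ∀ x : ℕ, x₁ ≤ x → ∀ M N : ℕ, (x : ℝ) ^ (1 / 3 - δ) ≤ M → (M : ℝ) ≤ (x : ℝ) ^ (1 / 2 : ℝ) →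
      (x : ℝ) ^ (1 - δ) ≤ (M : ℝ) * N → (M : ℝ) * N ≤ x → ∀ α β : ℕ → ℝ, (∀ n, |α n| ≤ 1) →
      (∀ n, |β n| ≤ 1) →
      (∀ n, α n ≠ 0 → ∀ p ∈ n.primeFactors, Real.exp (Real.log x / Real.log (Real.log x)) ≤ p) →
      (∀ n, β n ≠ 0 → ∀ p ∈ n.primeFactors, Real.exp (Real.log x / Real.log (Real.log x)) ≤ p) →
      ∀ h : ℤ, (h = 2 ∨ h = -2) →
      |∑ m ∈ Finset.Ioc M (2 * M), ∑ n ∈ Finset.Ioc N (2 * N),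
        α m * β n * (ArithmeticFunction.liouville (Int.toNat ((m : ℤ) * n + h)) : ℝ)| ≤
        (x : ℝ) / Real.log x ^ (90 : ℝ))
    (hK2 : ∀ x : ℕ, x₂ ≤ x → ∀ M N : ℕ, (x : ℝ) ^ (1 / 3 - δ) ≤ M → (M : ℝ) ≤ (x : ℝ) ^ (1 / 2 : ℝ) →
      (x : ℝ) ^ (1 - δ) ≤ (M : ℝ) * N → (M : ℝ) * N ≤ x → ∀ α β : ℕ → ℝ, (∀ n, |α n| ≤ 1) →
      (∀ n, |β n| ≤ 1) →
      (∀ n, α n ≠ 0 → ∀ p ∈ n.primeFactors, Real.exp (Real.log x / Real.log (Real.log x)) ≤ p) →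
      (∀ n, β n ≠ 0 → ∀ p ∈ n.primeFactors, Real.exp (Real.log x / Real.log (Real.log x)) ≤ p) →
      ∀ h : ℤ, (h = 2 ∨ h = -2) →
      (∑ d ∈ (Finset.Icc 1 ⌊(x : ℝ) ^ (1 / 2 - ε)⌋₊).filter (fun d : ℕ => Odd d),
        |(∑ m ∈ Finset.Ioc M (2 * M), ∑ n ∈ (Finset.Ioc N (2 * N)).filter
            (fun n : ℕ => (d : ℤ) ∣ (m : ℤ) * n + h),
            α m * β n * (ArithmeticFunction.liouville (Int.toNat ((m : ℤ) * n + h)) : ℝ)) -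
          (Nat.totient d : ℝ)⁻¹ * ∑ m ∈ Finset.Ioc M (2 * M), ∑ n ∈ Finset.Ioc N (2 * N),
            α m * β n * (ArithmeticFunction.liouville (Int.toNat ((m : ℤ) * n + h)) : ℝ)|) ≤
        (x : ℝ) / Real.log x ^ (90 : ℝ))
    {η : ℝ} (hη : 0 < η) :
    ∃ x₀ : ℕ, ∀ x : ℕ, x₀ ≤ x →
      (∑ d ∈ Finset.Icc 1 ⌊(x : ℝ) ^ (1 / 2 - ε)⌋₊,
        |∑ p ∈ (Nat.primesLE x).filter (fun p => d ∣ p + 2),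
          (ArithmeticFunction.liouville (p + 2) : ℝ)|) ≤ η * (x : ℝ) / Real.log x ^ 2 := by
  obtain ⟨x₃, c, hc, hTI⟩ := sifted_typeI 10 (δ / 2) ε (by norm_num) (by positivity)
    (by linarith) hε.le
  obtain ⟨Cτ, hCτ0, hCτ⟩ := sum_tau_tau_sq_le
  have hKη0 : (0 : ℝ) ≤ (16200 + 360 * (2 ^ (14 : ℕ) * Real.sqrt (Cτ + 1)) + 240) / η := by
    positivity
  have EV := (prime_thresholds hδ0 hε c _ hKη0).and ((eventually_ge_atTop x₁).and
    ((eventually_ge_atTop x₂).and (tendsto_natCast_atTop_atTop.eventually (eventually_ge_atTop x₃))))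
  obtain ⟨x₀, hx₀⟩ := Filter.eventually_atTop.mp EV
  refine ⟨x₀, fun x hx => ?_⟩
  obtain ⟨⟨h16, hL3, hcL, hll8, hx8, hxδ, hKL, hKpow, hKε⟩, hxx₁, hxx₂, hxx₃⟩ := hx₀ x hx
  clear EV hx₀
  -- basic facts
  have hx0 : (0 : ℝ) < x := by linarith
  have hx1 : (1 : ℝ) ≤ x := by linarith
  have hL1 : 1 ≤ Real.log x := by linarith
  have hL0 : 0 < Real.log x := by linarith
  have hδ3 : δ ≤ 1 / 3 := by linarith
  have hx3 : 3 ≤ x := by exact_mod_cast (show (3 : ℝ) ≤ x by linarith)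
  have hll0 : 0 < Real.log (Real.log x) := by linarith
  have hq1 : 1 ≤ Real.log x / Real.log (Real.log x) := by linarith
  have hmono : ∀ {a b : ℝ}, a ≤ b → (x : ℝ) ^ a ≤ (x : ℝ) ^ b :=
    fun h => Real.rpow_le_rpow_of_exponent_le hx1 h
  -- the rough cut `w` and `N = ⌈w⌉`
  have hw2 : 2 < Real.exp (Real.log x / Real.log (Real.log x)) := by
    have := Real.add_one_lt_exp (by positivity : Real.log x / Real.log (Real.log x) ≠ 0)
    linarith
  have hw0 : 0 < Real.exp (Real.log x / Real.log (Real.log x)) := Real.exp_pos _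
  obtain ⟨N, hN⟩ : ∃ N : ℕ, N = ⌈Real.exp (Real.log x / Real.log (Real.log x))⌉₊ := ⟨_, rfl⟩
  have hNw : Real.exp (Real.log x / Real.log (Real.log x)) ≤ N := hN ▸ Nat.le_ceil _
  have hNle : (N : ℝ) ≤ Real.exp (Real.log x / Real.log (Real.log x)) + 1 :=
    hN ▸ (Nat.ceil_lt_add_one hw0.le).le
  have hN3 : 3 ≤ N := by
    have : (2 : ℝ) < N := by linarith
    have : 2 < N := by exact_mod_cast this
    omega
  have hw8 : Real.exp (Real.log x / Real.log (Real.log x)) ≤ (x : ℝ) ^ (1 / 8 : ℝ) := by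
    rw [Real.rpow_def_of_pos hx0]
    refine Real.exp_le_exp.mpr ?_
    rw [div_le_iff₀ hll0]
    nlinarith
  have hNx4 : (N : ℝ) ≤ (x : ℝ) ^ (1 / 4 : ℝ) := by
    have e : (x : ℝ) ^ (1 / 4 : ℝ) = (x : ℝ) ^ (1 / 8 : ℝ) * (x : ℝ) ^ (1 / 8 : ℝ) := by
      rw [← Real.rpow_add hx0]; norm_num
    rw [e]
    have hw1 : 1 ≤ Real.exp (Real.log x / Real.log (Real.log x)) := by linarith
    have := mul_le_mul hw8 hw8 hw0.le (by positivity)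
    nlinarith [this, hx8]
  have hNx : (N : ℝ) ≤ x := hNx4.trans (by
    calc (x : ℝ) ^ (1 / 4 : ℝ) ≤ (x : ℝ) ^ (1 : ℝ) := hmono (by norm_num)
      _ = x := Real.rpow_one _)
  have hcN : 2 * c ≤ Real.log N := by
    have := Real.log_le_log hw0 hNw
    rw [Real.log_exp] at this
    linarith
  have hNhi : Real.log N ≤ 2 * Real.log x / Real.log (Real.log x) := by
    have hN2w : (N : ℝ) ≤ 2 * Real.exp (Real.log x / Real.log (Real.log x)) := by linarith
    have hN0 : (0 : ℝ) < N := by exact_mod_cast (show 0 < N by omega)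
    have := Real.log_le_log hN0 hN2w
    rw [Real.log_mul (by norm_num) hw0.ne', Real.log_exp] at this
    have hlog2 : Real.log 2 < 1 := by
      have := Real.log_two_lt_d9; linarith
    have e : 2 * Real.log x / Real.log (Real.log x) = 2 * (Real.log x / Real.log (Real.log x)) := by
      ring
    rw [e]; linarith
  -- the Type-I cut `U = ⌊x^{1/3 - δ/2}⌋`
  have hu1 : (1 : ℝ) ≤ (x : ℝ) ^ (1 / 3 - δ / 2) := Real.one_le_rpow hx1 (by linarith)
  have hu0 : (0 : ℝ) ≤ (x : ℝ) ^ (1 / 3 - δ / 2) := by linarith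
  have hU1 : 1 ≤ ⌊(x : ℝ) ^ (1 / 3 - δ / 2)⌋₊ := (Nat.one_le_floor_iff _).mpr hu1
  have hUle : (⌊(x : ℝ) ^ (1 / 3 - δ / 2)⌋₊ : ℝ) ≤ (x : ℝ) ^ (1 / 3 - δ / 2) := Nat.floor_le hu0
  have hUgt : (x : ℝ) ^ (1 / 3 - δ / 2) - 1 < ⌊(x : ℝ) ^ (1 / 3 - δ / 2)⌋₊ := Nat.sub_one_lt_floor _
  have ha1 : (1 : ℝ) ≤ (x : ℝ) ^ (1 / 3 - δ) := Real.one_le_rpow hx1 (by linarith)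
  have hua : (x : ℝ) ^ (1 / 3 - δ / 2) = (x : ℝ) ^ (1 / 3 - δ) * (x : ℝ) ^ (δ / 2) := by
    rw [← Real.rpow_add hx0]; ring_nf
  have hUlo : (1 + Real.log x ^ (-(34 : ℝ))) * ((x : ℝ) ^ (1 / 3 - δ) + 1) ≤
      (⌊(x : ℝ) ^ (1 / 3 - δ / 2)⌋₊ : ℝ) := by
    have h34 : Real.log x ^ (-(34 : ℝ)) ≤ 1 := Real.rpow_le_one_of_one_le_of_nonpos hL1 (by norm_num)
    have h5 : 5 * (x : ℝ) ^ (1 / 3 - δ) ≤ (x : ℝ) ^ (1 / 3 - δ / 2) := by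
      rw [hua]
      have := mul_le_mul_of_nonneg_left hxδ (by linarith only [ha1] : (0 : ℝ) ≤ (x : ℝ) ^ (1 / 3 - δ))
      linarith only [this]
    have ha0 : 0 ≤ (x : ℝ) ^ (1 / 3 - δ) + 1 := by linarith only [ha1]
    have hprod := mul_le_mul_of_nonneg_right h34 ha0
    have e : (1 + Real.log x ^ (-(34 : ℝ))) * ((x : ℝ) ^ (1 / 3 - δ) + 1) =
        ((x : ℝ) ^ (1 / 3 - δ) + 1) + Real.log x ^ (-(34 : ℝ)) * ((x : ℝ) ^ (1 / 3 - δ) + 1) := by ring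
    rw [e]
    linarith only [hprod, h5, hUgt, ha1]
  have hxδ' : 2 ≤ (x : ℝ) ^ δ :=
    le_trans (by linarith only [hxδ]) (hmono (by linarith only [hδ0]) : (x : ℝ) ^ (δ / 2) ≤ (x : ℝ) ^ δ)
  have hUsq : ((⌊(x : ℝ) ^ (1 / 3 - δ / 2)⌋₊ : ℕ) : ℝ) ^ 2 ≤ (x : ℝ) ^ (2 / 3 - δ) := by
    have e : ((x : ℝ) ^ (1 / 3 - δ / 2)) ^ 2 = (x : ℝ) ^ (2 / 3 - δ) := by
      rw [← Real.rpow_natCast, ← Real.rpow_mul hx0.le]; ring_nf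
    rw [← e]; exact pow_le_pow_left₀ (Nat.cast_nonneg _) hUle 2
  have hUhi : 2 * (((⌊(x : ℝ) ^ (1 / 3 - δ / 2)⌋₊ * ⌊(x : ℝ) ^ (1 / 3 - δ / 2)⌋₊ : ℕ) : ℝ)) ≤
      (x : ℝ) ^ (2 / 3 : ℝ) := by
    have e : (x : ℝ) ^ (2 / 3 : ℝ) = (x : ℝ) ^ (2 / 3 - δ) * (x : ℝ) ^ δ := by
      rw [← Real.rpow_add hx0]; ring_nf
    push_cast
    rw [← sq, e]
    have h0 : 0 ≤ (x : ℝ) ^ (2 / 3 - δ) := by positivity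
    have := mul_le_mul hUsq hxδ' (by norm_num) h0
    linarith only [this]
  have hx6 : 2 ≤ (x : ℝ) ^ (1 / 6 : ℝ) := hx8.trans (hmono (by norm_num))
  have hsq : 2 * ((Nat.sqrt x : ℕ) : ℝ) ≤ (x : ℝ) ^ (2 / 3 : ℝ) := by
    have h1 : ((Nat.sqrt x : ℕ) : ℝ) ≤ (x : ℝ) ^ (1 / 2 : ℝ) := by
      rw [← Real.sqrt_eq_rpow]
      refine (Real.le_sqrt (Nat.cast_nonneg _) (Nat.cast_nonneg _)).mpr ?_
      exact_mod_cast Nat.sqrt_le' x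
    have e : (x : ℝ) ^ (2 / 3 : ℝ) = (x : ℝ) ^ (1 / 2 : ℝ) * (x : ℝ) ^ (1 / 6 : ℝ) := by
      rw [← Real.rpow_add hx0]; norm_num
    rw [e]
    have h0 : 0 ≤ (x : ℝ) ^ (1 / 2 : ℝ) := by positivity
    have := mul_le_mul h1 hx6 (by norm_num) h0
    linarith only [this]
  -- the brick at this `x`, the sifted Type-I bound, the level sums at all heights
  have hK1x := hK1 x hxx₁
  have hK2x := hK2 x hxx₂
  have HTI : ∀ u : ℕ, u ≤ x → ∀ cb : ℕ → ℝ, (∀ b, |cb b| ≤ 1) →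
      (∀ b, cb b ≠ 0 → Nat.Coprime b (primorial (N - 1))) →
      ∑ d ∈ (Icc 1 ⌊(x : ℝ) ^ (1 / 2 - ε)⌋₊).filter (fun d : ℕ => Odd d),
        |∑ b ∈ Icc 1 ⌊(x : ℝ) ^ (1 / 3 - δ / 2)⌋₊, cb b *
          ∑ t ∈ (Icc 1 (u / b)).filter (fun t => Nat.Coprime t (primorial (N - 1))),
            (if d ∣ b * t + 2 then (liouville (b * t + 2) : ℝ) else 0)| ≤
        (x : ℝ) / Real.log x ^ (10 : ℝ) :=
    fun u hu cb hcb hcbP => hTI x hxx₃ u hu N hN3 hNx hcN hNhi cb hcb hcbP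
  have hlevel := level_sum_le_all_heights (x := x) (U := ⌊(x : ℝ) ^ (1 / 3 - δ / 2)⌋₊) (N := N)
    (δ := δ) (ε := ε) (Cτ := Cτ) h16 hL3 hε.le hδ0 hδ3 hCτ0.le hw2 hNw hK1x hK2x
    hCτ hU1 hUlo hUhi hsq HTI
  -- envelope and numerics
  have hUx3 : (⌊(x : ℝ) ^ (1 / 3 - δ / 2)⌋₊ : ℝ) ≤ (x : ℝ) ^ (1 / 3 : ℝ) :=
    hUle.trans (hmono (by linarith only [hδ0]))
  have hx23 : 2 ≤ (x : ℝ) ^ (2 / 3 : ℝ) := hx8.trans (hmono (by norm_num))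
  have hUUx : ⌊(x : ℝ) ^ (1 / 3 - δ / 2)⌋₊ * ⌊(x : ℝ) ^ (1 / 3 - δ / 2)⌋₊ ≤ x := by
    have h1 : (x : ℝ) ^ (2 / 3 : ℝ) ≤ x := by
      calc (x : ℝ) ^ (2 / 3 : ℝ) ≤ (x : ℝ) ^ (1 : ℝ) := hmono (by norm_num)
        _ = x := Real.rpow_one _
    have : (((⌊(x : ℝ) ^ (1 / 3 - δ / 2)⌋₊ * ⌊(x : ℝ) ^ (1 / 3 - δ / 2)⌋₊ : ℕ) : ℝ)) ≤ x := by
      have h0 : (0 : ℝ) ≤ ((⌊(x : ℝ) ^ (1 / 3 - δ / 2)⌋₊ * ⌊(x : ℝ) ^ (1 / 3 - δ / 2)⌋₊ : ℕ) : ℝ) :=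
        Nat.cast_nonneg _
      linarith only [hUhi, h1, h0]
    exact_mod_cast this
  have henv := level_envelope_le (δ := δ) h16 hL1 hε.le hCτ0.le hUx3 hUUx hNx4 hx23
  have hKL' : (16200 + 360 * (2 ^ (14 : ℕ) * Real.sqrt (Cτ + 1)) + 240) ≤ η * Real.log x := by
    have := (div_le_iff₀ hη).mp hKL; linarith only [this]
  have hKpow' : (16200 + 360 * (2 ^ (14 : ℕ) * Real.sqrt (Cτ + 1)) + 240) * Real.log x ^ 15 ≤
      η * (x : ℝ) ^ (δ / 2) := by
    have := hKpow; rw [div_mul_eq_mul_div, div_le_iff₀ hη] at this; linarith only [this]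
  have hKε' : (16200 + 360 * (2 ^ (14 : ℕ) * Real.sqrt (Cτ + 1)) + 240) * Real.log x ^ 3 ≤
      η * (x : ℝ) ^ ε := by
    have := hKε; rw [div_mul_eq_mul_div, div_le_iff₀ hη] at this; linarith only [this]
  have hnum := final_numeric_le (ε := ε) h16 hL1 hη hδ0 hδ1 hCτ0.le hKL' hKpow' hKε'
  -- partial summation from primes to `Λ`
  have hf1 : ∀ d k : ℕ, |(if d ∣ k + 2 then (liouville (k + 2) : ℝ) else 0)| ≤ 1 := by
    intro d k
    split_ifs
    · exact Literature.NumberTheory.LFunctions.LiouvilleSum.abs_liouville_le_one _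
    · simp
  have hab := sum_abs_primes_le_abel (Icc 1 ⌊(x : ℝ) ^ (1 / 2 - ε)⌋₊)
    (fun d k => if d ∣ k + 2 then (liouville (k + 2) : ℝ) else 0) hf1 hx3
  have hLHS : ∑ d ∈ Icc 1 ⌊(x : ℝ) ^ (1 / 2 - ε)⌋₊,
      |∑ p ∈ (Nat.primesLE x).filter (fun p => d ∣ p + 2), (liouville (p + 2) : ℝ)| =
      ∑ d ∈ Icc 1 ⌊(x : ℝ) ^ (1 / 2 - ε)⌋₊,
        |∑ p ∈ Nat.primesLE x, (if d ∣ p + 2 then (liouville (p + 2) : ℝ) else 0)| := by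
    refine Finset.sum_congr rfl fun d _ => ?_
    rw [Finset.sum_filter]
  rw [hLHS]
  refine hab.trans ?_
  -- name the envelope
  set Senv : ℝ := 6 * (x : ℝ) ^ (2 / 3 : ℝ) * Real.log x ^ 2 + 6 * (x : ℝ) ^ (5 / 6 : ℝ) +
      3 * (x : ℝ) ^ (3 / 4 : ℝ) * Real.log x ^ 2 + 4 * (x : ℝ) / Real.log x ^ (9 : ℝ) +
      405 * (x : ℝ) / Real.log x ^ (15 : ℝ) +
      9 * (2 ^ (14 : ℕ) * Real.sqrt (Cτ + 1)) * ((x : ℝ) / Real.log x ^ (4 : ℝ)) +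
      9 * (2 ^ (14 : ℕ) * Real.sqrt (Cτ + 1)) * ((x : ℝ) ^ (1 - δ / 2) * Real.log x ^ (13 : ℝ)) +
      3 * (x : ℝ) ^ (1 / 2 : ℝ) * Real.log x with hSenv
  clear_value Senv
  have hS : ∀ i : ℕ, i ≤ x → ∑ d ∈ Icc 1 ⌊(x : ℝ) ^ (1 / 2 - ε)⌋₊, |∑ k ∈ Icc 1 i, vonMangoldt k *
      (if d ∣ k + 2 then (liouville (k + 2) : ℝ) else 0)| ≤ Senv :=
    fun i hi => (hlevel i hi).trans henv
  have hSenv0 : 0 ≤ Senv := le_trans (Finset.sum_nonneg fun _ _ => abs_nonneg _) (hS 0 (Nat.zero_le _))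
  -- the three pieces
  have hP1 : 1 / Real.log x * ∑ d ∈ Icc 1 ⌊(x : ℝ) ^ (1 / 2 - ε)⌋₊, |∑ k ∈ Icc 1 x, vonMangoldt k *
      (if d ∣ k + 2 then (liouville (k + 2) : ℝ) else 0)| ≤ Senv := by
    have h1 : 1 / Real.log x ≤ 1 := by rw [div_le_one hL0]; exact hL1
    calc _ ≤ 1 / Real.log x * Senv := mul_le_mul_of_nonneg_left (hS x le_rfl) (by positivity)
      _ ≤ 1 * Senv := mul_le_mul_of_nonneg_right h1 hSenv0
      _ = Senv := one_mul _
  have hP2 : ∑ i ∈ range x, |1 / Real.log i - 1 / Real.log (i + 1)| *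
      ∑ d ∈ Icc 1 ⌊(x : ℝ) ^ (1 / 2 - ε)⌋₊, |∑ k ∈ Icc 1 i, vonMangoldt k *
        (if d ∣ k + 2 then (liouville (k + 2) : ℝ) else 0)| ≤ 3 * Senv := by
    calc _ ≤ ∑ i ∈ range x, |1 / Real.log i - 1 / Real.log (i + 1)| * Senv := by
          refine Finset.sum_le_sum fun i hi => ?_
          exact mul_le_mul_of_nonneg_left (hS i (Finset.mem_range.mp hi).le) (abs_nonneg _)
      _ = (∑ i ∈ range x, |1 / Real.log i - 1 / Real.log (i + 1)|) * Senv := by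
          rw [Finset.sum_mul]
      _ ≤ 3 * Senv := mul_le_mul_of_nonneg_right (sum_abs_logWeights_le x) hSenv0
  have hP3 : (#(Icc 1 ⌊(x : ℝ) ^ (1 / 2 - ε)⌋₊) : ℝ) * (8 * Real.sqrt x * Real.log x) ≤
      8 * (x : ℝ) ^ (1 - ε) * Real.log x := by
    rw [Nat.card_Icc, Nat.add_sub_cancel]
    have hD : (⌊(x : ℝ) ^ (1 / 2 - ε)⌋₊ : ℝ) ≤ (x : ℝ) ^ (1 / 2 - ε) := Nat.floor_le (by positivity)
    have e : (x : ℝ) ^ (1 - ε) = (x : ℝ) ^ (1 / 2 - ε) * Real.sqrt x := by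
      rw [Real.sqrt_eq_rpow, ← Real.rpow_add hx0]; ring_nf
    rw [e]
    have h0 : 0 ≤ 8 * Real.sqrt x * Real.log x := by positivity
    have h1 := mul_le_mul_of_nonneg_right hD h0
    have e2 : (x : ℝ) ^ (1 / 2 - ε) * (8 * Real.sqrt x * Real.log x) =
        8 * ((x : ℝ) ^ (1 / 2 - ε) * Real.sqrt x) * Real.log x := by ring
    linarith only [h1, e2]
  linarith only [hP1, hP2, hP3, hnum]

end Summit.Parity.GeneralizedHardyLittlewood.Theorems
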